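import Literature.MathematicalPhysics.QuantumFieldTheory.Balaban1983to89.B6StairStokesTorus
import Literature.MathematicalPhysics.QuantumFieldTheory.BalabanImbrieJaffe1984to88.BIJ85CurlQsstar

/-!
# `Balaban1983to89.B6Ineq2123CentredTorus` — T. Bałaban, *Propagators and renormalization transformations for lattice gauge
# theories. II*, Commun. Math. Phys. **96** (1984) 223–250 [Balaban1984PropagatorsII], p. 244, (2.123): the tree-gauge Poincaré
# inequality INSIDE ONE BLOCK, `Σ_{b⊂B(y)}|B(b)|² ≤ const(d,L)·Σ_{p⊂B(y)}|(∂₁B)(p)|²` in the axial gauge (2.121) — FOR THE CENTRED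
# STAIRCASE TREES `Γ_{y,x}` of the V1 torus calculus (the bound, from the Stokes identity of `…B6StairStokesTorus`)

statement-level skeleton of published theorems with citation tags; proofs where landed; nothing here is a claim about the Yang–Mills mass gap

PDF held: `paper:balaban1984-cmp96-propagators-rt-ii` (journal page = PDF page + 222; p. 244 [PDF 22] read AS IMAGE on the ×4 render
`run/shared/lean/pub/pub-balaban/b2b-balaban-ref1/pages/1984-cmp96-propagators-rt-II/…-p022-x4.png`, 2026-08-21).

PRINT (verbatim, p. 244).  *"We will prove that it is bounded from below by γ₀″‖B‖² on the configurations B satisfying (2.121). Let us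
consider at first the bonds b ⊂ B(y), y ∈ Λ′. For b = ⟨x, x + e₂⟩, we have B(x, x + e₂) = (B(x, x + e₂) − B(x − e₁, x − e₁ + e₂)) + …
+ (B((y₁ + 1, x₂, …, x_d), (y₁ + 1, x₂ + 1, …, x_d)) − B((y₁, x₂, …, x_d), (y₁, x₂ + 1, …, x_d))) = Σ(∂₁B)(p(x′)), the sum is over the
plaquettes p(x′) determined by the points x′ ∈ [(y₁, x₂, …, x_d), x] and vectors e₁, e₂, so |B(x, x + e₂)|² ≤ |x₁ − y₁| Σ|(∂₁B)(p(x′))|².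
… For arbitrary j, 2 ≤ j ≤ d, we have |B(x, x + e_j)|² ≤ (|x₁ − y₁| + … + |x_{j−1} − y_{j−1}|) Σ|(∂₁B)(p(x′))|², … and the plaquettes
p(x′) are parallel to (e_{j−1}, e_j), …, (e₁, e_j). We sum the above inequalities over x and j = 2, …, d. … hence
Σ_{b⊂B(y)} |B(b)|² ≤ dL^d Σ_{p⊂B(y)} |(∂₁B)(p)|². (2.123)"*

CITATION HEADER (lean-in-tree rule) — WHAT IS REPRODUCED.  Phase-2 file of the `lit-balaban` typed skeleton (HOME
`run/shared/lean/pub/lit-balaban/`), seat **p22 gen 11** (B6 fold owner r03, referee ref-4; lane = the Sect. C chain (2.95)–(2.147) on the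
concrete two-scale data `tsV1`).  SKELETON rows **B6.Eq2.120 / B6.Txt@246** (the printed claim *"(2.122) ≥ γ₀″‖B‖² on (2.121)"*, of which
(2.123) is the first step; decls of record untouched: b06's `…B6TreeGaugePoincare.ineq2123` and r03's `…B6Form2122LowerBound.form2122_lower`
are the CORNER-anchored ℤ^d versions; the V1 calculus fixes the axial gauge along the CENTRED staircases `Γ_{emb y, x}` of
`LatticeFieldCalculus.stairSum` — DIVERGENCE F3 — for which (2.123) was not in the tree).  THIS FILE, on the unit torus `T^{(j)}`
(`j + 1 ≤ m + K`):
IMPORTS BY NAME the Stokes identity of the same seat, `…B6StairStokesTorus.apply_eq_stairSum_sub_add` (`A⟨x,μ⟩ = A(Γ_{y₀,x+e_μ}) − A(Γ_{y₀,x}) +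
Σ_{ν<μ} Σ_t^{(n_ν)} oc`, with `zsum`, `oc`, `stepSite`, `InRange`, `zsum_sq_le`) and p31's block-point lemmas `…BIJ85CurlQsstar.shift_blockSite_of_lt/_of_eq`,
`…BIJ85Eq219Proof.runSite_blockSite_of_lt/_of_ge`, p08's `…BIJ85GaugeFunction5113.exists_blockSite_eq`.  THIS FILE:
* block-point calculus: `valMinAbs_blockSite_sub_emb` (signed run lengths `r_μ − (L−1)/2`), `stepSite_blockSite`,
  `mixSite_emb_blockSite`, **`blockOf_stepSite_mixSite`** (the plaquettes met by the translated runs lie in `B(y)`),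
  `shift_ne_self` / `exists_offset_of_inBlock` (a bond with both end points in `B(y)` is `⟨(y,r), μ⟩` with `r_μ + 1 < L`), `card_srcBlock` (`dL^d` bonds
  start in a block);
* **`apply_eq_sum_zsum_of_axial`**: in the gauge (2.121) of `B(y)` (`B(Γ_{emb y, x}) = 0`, `x ∈ B(y)`), `B(b) = Σ_{ν<μ} Σ_t^{(r_ν−(L−1)/2)} oc B ν μ (z_ν+te_ν)`
  for `b = ⟨(y,r), μ⟩ ⊂ B(y)` — the printed `B(x, x + e_j) = Σ(∂₁B)(p(x′))`, centred;
* **(2.123) for centred trees**: `sq_le_curlBlk` — `|B(b)|² ≤ d²L² Σ_{p : p₋∈B(y)} |(∂₁B)(p)|²` — and summed over the block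
  **`inBlk_le_curlBlk`**: `Σ_{b⊂B(y)} |B(b)|² ≤ d³L^{d+2} Σ_{p : p₋∈B(y)} |(∂₁B)(p)|²`.
THEOREMS ONLY (no definition, no `def … : Prop` fact); standard axioms.  HONEST SCOPE: CONSTANTS OURS (`d²L²`, `d³L^{d+2}` in
place of the printed `dL^d`: each plaquette variable is bounded by the whole block sum instead of the printed multiplicity count); the plaquette sum runs over the plaquettes whose lowest corner lies in `B(y)` (a superset of *"p ⊂ B(y)"*, all
that the assembly needs); unit lattice factor `1` in `curl`; finite tori of the V1 calculus, centred blocks (`L` odd); NOT summit progress.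
-/

noncomputable section

open scoped BigOperators

namespace Literature.MathematicalPhysics.QuantumFieldTheory.Balaban1983to89.B6Ineq2123CentredTorus

open LatticeFieldCalculus B6SectCTwoScaleV1 B6StairStokesTorus
open BalabanImbrieJaffe1984to88.BIJ85Eq219Proof (runSite_blockSite_of_lt runSite_blockSite_of_ge)
open BalabanImbrieJaffe1984to88.BIJ85CurlQsstar (shift_blockSite_of_lt shift_blockSite_of_eq)
open BalabanImbrieJaffe1984to88.BIJ85GaugeFunction5113 (exists_blockSite_eq)

variable {P : Params} {j : ℕ}

/-! ## §4  (2.123) for the centred trees: a bond inside an axially gauged block is controlled by the block's plaquettes -/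

section Block

variable {V : Type*} [AddCommGroup V]

/-- `2L ≤ N_j` in the standing range. [folklore] -/
private theorem two_mul_L_le_sitesPerDir (hj : j + 1 ≤ P.m + P.K) : 2 * P.L ≤ P.sitesPerDir j := by
  rw [P.sitesPerDir_eq_mul_succ hj]
  exact Nat.mul_le_mul_right _ (P.one_lt_sitesPerDir (j + 1))

/-- the signed length of the `μ`-run of `Γ_{emb y, x}`, `x = (y, r)`: `r_μ − (L−1)/2` (p16/p09/gen-10 private lemma, re-derived).
[cite: Balaban1984PropagatorsI, (1.7) p.18] -/
theorem valMinAbs_blockSite_sub_emb (hj : j + 1 ≤ P.m + P.K) (y : Site P (j + 1)) (r : Fin P.d → Fin P.L) (μ : Fin P.d) :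
    ((Site.blockSite y r) μ - (emb y) μ).valMinAbs = ((r μ : ℕ) : ℤ) - (((P.L - 1) / 2 : ℕ) : ℤ) := by
  rw [ZMod.valMinAbs_spec]
  have hr := (r μ).isLt
  have hL : 1 < P.L := P.hL.2
  have h2L := two_mul_L_le_sitesPerDir (P := P) hj
  have hh : (P.L - 1) / 2 < P.L := by omega
  have h2 : 2 * (P.L : ℤ) ≤ (P.sitesPerDir j : ℤ) := by exact_mod_cast h2L
  refine ⟨?_, ?_, ?_⟩
  · have e1 : (Site.blockSite y r) μ = (((y μ).val * P.L + r μ : ℕ) : ZMod (P.sitesPerDir j)) := rfl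
    have e2 : (emb y) μ = (((y μ).val * P.L + (P.L - 1) / 2 : ℕ) : ZMod (P.sitesPerDir j)) := rfl
    rw [e1, e2, Int.cast_sub, Int.cast_natCast, Int.cast_natCast, Nat.cast_add, Nat.cast_add, add_sub_add_left_eq_sub]
  · have h1 : (((P.L - 1) / 2 : ℕ) : ℤ) < (P.L : ℤ) := by exact_mod_cast hh
    have h3 : (0 : ℤ) ≤ ((r μ : ℕ) : ℤ) := Int.natCast_nonneg _
    linarith
  · have h1 : ((r μ : ℕ) : ℤ) < (P.L : ℤ) := by exact_mod_cast hr
    have h3 : (0 : ℤ) ≤ (((P.L - 1) / 2 : ℕ) : ℤ) := Int.natCast_nonneg _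
    linarith

/-- a signed number of steps inside the block changes only the offset. [cite: Balaban1987RG1, (0.3) p.252] -/
theorem stepSite_blockSite (y : Site P (j + 1)) (r : Fin P.d → Fin P.L) (ν : Fin P.d) (t : ℤ)
    (h0 : 0 ≤ ((r ν : ℕ) : ℤ) + t) (hL : ((r ν : ℕ) : ℤ) + t < P.L) :
    stepSite P j (Site.blockSite y r) ν t =
      Site.blockSite y (Function.update r ν ⟨(((r ν : ℕ) : ℤ) + t).toNat, by omega⟩) := by
  funext κ
  by_cases hκ : κ = ν
  · subst hκ
    rw [stepSite_apply_self]
    simp only [Site.blockSite, Function.update_self]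
    have hm : (((((r κ : ℕ) : ℤ) + t).toNat : ℕ) : ℤ) = ((r κ : ℕ) : ℤ) + t := Int.toNat_of_nonneg h0
    have e : (((((r κ : ℕ) : ℤ) + t).toNat : ℕ) : ZMod (P.sitesPerDir j)) = ((r κ : ℕ) : ZMod (P.sitesPerDir j)) + (t : ZMod (P.sitesPerDir j)) := by
      rw [← Int.cast_natCast (R := ZMod (P.sitesPerDir j)) (((r κ : ℕ) : ℤ) + t).toNat, hm]
      push_cast
      ring
    push_cast
    rw [e]
    ring
  · rw [stepSite_apply_ne _ hκ]
    simp only [Site.blockSite, Function.update_of_ne hκ]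

/-- the corner at which the `ν`-run of `Γ_{emb y, x}` starts is a block point with centre offsets in the directions `≤ ν`. [cite: Balaban1984PropagatorsI, (1.7) p.18] -/
theorem mixSite_emb_blockSite (y : Site P (j + 1)) (r : Fin P.d → Fin P.L) (ν : Fin P.d) (hh : (P.L - 1) / 2 < P.L) :
    mixSite ν (emb y) (Site.blockSite y r) = Site.blockSite y (fun κ => if ν < κ then r κ else ⟨(P.L - 1) / 2, hh⟩) := by
  funext κ
  simp only [mixSite, Site.blockSite, emb]
  split_ifs <;> rfl

/-- **the plaquettes met by the translated runs lie in the block**: for `x = (y, r) ∈ B(y)` and `t` between `0` and the signed length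
`r_ν − (L−1)/2` of the `ν`-run, the site `z_ν + te_ν` is a point of `B(y)`. [cite: Balaban1984PropagatorsII, (2.123) p.244] -/
theorem blockOf_stepSite_mixSite (hj : j + 1 ≤ P.m + P.K) (y : Site P (j + 1)) (r : Fin P.d → Fin P.L) (ν : Fin P.d) {t : ℤ}
    (ht : InRange (((r ν : ℕ) : ℤ) - (((P.L - 1) / 2 : ℕ) : ℤ)) t) :
    blockOf (stepSite P j (mixSite ν (emb y) (Site.blockSite y r)) ν t) = y := by
  have hL : 1 < P.L := P.hL.2
  have hh : (P.L - 1) / 2 < P.L := by omega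
  have hr := (r ν).isLt
  rw [mixSite_emb_blockSite y r ν hh]
  set r' : Fin P.d → Fin P.L := fun κ => if ν < κ then r κ else ⟨(P.L - 1) / 2, hh⟩ with hr'
  have hr'ν : ((r' ν : ℕ) : ℤ) = (((P.L - 1) / 2 : ℕ) : ℤ) := by simp [hr']
  have h0 : 0 ≤ ((r' ν : ℕ) : ℤ) + t := by
    rw [hr'ν]; unfold InRange at ht; omega
  have h1 : ((r' ν : ℕ) : ℤ) + t < P.L := by
    rw [hr'ν]; unfold InRange at ht
    have : (((P.L - 1) / 2 : ℕ) : ℤ) < P.L := by exact_mod_cast hh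
    omega
  rw [stepSite_blockSite y r' ν t h0 h1, Site.blockOf_blockSite hj]

/-- **in the axial gauge of `B(y)` a bond inside the block is a signed sum of block plaquette variables** (the printed identity
`B(x, x + e_j) = Σ(∂₁B)(p(x′))` for the centred trees): for `B` with `B(Γ_{y,x}) = 0`, `x ∈ B(y)`, and `b = ⟨x, x + e_μ⟩ ⊂ B(y)`, `x = (y, r)`,
`B(b) = Σ_{ν<μ} Σ_t^{(r_ν − (L−1)/2)} oc B ν μ (z_ν + te_ν)`. [cite: Balaban1984PropagatorsII, (2.123) p.244] -/
theorem apply_eq_sum_zsum_of_axial (hj : j + 1 ≤ P.m + P.K) (B : VecField P j V) (y : Site P (j + 1))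
    (hB : ∀ r : Fin P.d → Fin P.L, stairSum B (emb y) (Site.blockSite y r) = 0)
    (r : Fin P.d → Fin P.L) (μ : Fin P.d) (hμ : (r μ : ℕ) + 1 < P.L) :
    B ⟨Site.blockSite y r, μ⟩ = ∑ ν ∈ Finset.univ.filter (fun ν : Fin P.d => ν < μ),
      zsum (fun t => oc B ν μ (stepSite P j (mixSite ν (emb y) (Site.blockSite y r)) ν t))
        (((r ν : ℕ) : ℤ) - (((P.L - 1) / 2 : ℕ) : ℤ)) := by
  have hwrap : (((Site.blockSite y r).shift μ) μ - (emb y) μ).valMinAbs = ((Site.blockSite y r) μ - (emb y) μ).valMinAbs + 1 := by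
    rw [shift_blockSite_of_lt y r μ hμ, valMinAbs_blockSite_sub_emb hj, valMinAbs_blockSite_sub_emb hj, Function.update_self]
    push_cast
    ring
  rw [apply_eq_stairSum_sub_add B (emb y) (Site.blockSite y r) μ hwrap, shift_blockSite_of_lt y r μ hμ, hB, hB, sub_zero, zero_add]
  refine Finset.sum_congr rfl fun ν _ => ?_
  rw [valMinAbs_blockSite_sub_emb hj]

/-- the signed run lengths inside a block are at most `L` in absolute value. [folklore] -/
private theorem natAbs_offset_le (r : Fin P.d → Fin P.L) (ν : Fin P.d) :
    (((((r ν : ℕ) : ℤ) - (((P.L - 1) / 2 : ℕ) : ℤ)).natAbs : ℕ) : ℝ) ≤ P.L := by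
  have hL : 1 < P.L := P.hL.2
  have hr := (r ν).isLt
  have hh : (P.L - 1) / 2 < P.L := by omega
  have h : (((r ν : ℕ) : ℤ) - (((P.L - 1) / 2 : ℕ) : ℤ)).natAbs ≤ P.L := by omega
  exact_mod_cast h

/-- **(2.123), centred trees, one bond**: for `B` axial on `B(y)` and `b = ⟨x, x + e_μ⟩ ⊂ B(y)`,
`|B(b)|² ≤ d²L² Σ_{p : p₋ ∈ B(y)} |(∂₁B)(p)|²` (printed: `≤ (|x₁ − y₁| + … + |x_{j−1} − y_{j−1}|) Σ|(∂₁B)(p(x′))|²` over the plaquettes met;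
here each plaquette variable is bounded by the block sum — constant ours). [cite: Balaban1984PropagatorsII, (2.123) p.244] -/
theorem sq_le_curlBlk (hj : j + 1 ≤ P.m + P.K) (B : VecField P j ℝ) (y : Site P (j + 1))
    (hB : ∀ r : Fin P.d → Fin P.L, stairSum B (emb y) (Site.blockSite y r) = 0)
    (r : Fin P.d → Fin P.L) (μ : Fin P.d) (hμ : (r μ : ℕ) + 1 < P.L) :
    B ⟨Site.blockSite y r, μ⟩ ^ 2 ≤ (P.d : ℝ) ^ 2 * (P.L : ℝ) ^ 2 *
      ∑ p ∈ Finset.univ.filter (fun p : Plaq P j => blockOf p.src = y), curl 1 B p ^ 2 := by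
  classical
  set M := ∑ p ∈ Finset.univ.filter (fun p : Plaq P j => blockOf p.src = y), curl 1 B p ^ 2 with hM
  have hM0 : 0 ≤ M := Finset.sum_nonneg fun _ _ => sq_nonneg _
  set S := Finset.univ.filter (fun ν : Fin P.d => ν < μ) with hS
  have hcard : (S.card : ℝ) ≤ P.d := by
    have h := Finset.card_filter_le Finset.univ (fun ν : Fin P.d => ν < μ)
    rw [Finset.card_univ, Fintype.card_fin] at h
    exact_mod_cast h
  set Z : Fin P.d → ℝ := fun ν => zsum (fun t => oc B ν μ (stepSite P j (mixSite ν (emb y) (Site.blockSite y r)) ν t))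
    (((r ν : ℕ) : ℤ) - (((P.L - 1) / 2 : ℕ) : ℤ)) with hZ
  have hZle : ∀ ν ∈ S, Z ν ^ 2 ≤ (P.L : ℝ) ^ 2 * M := by
    intro ν hν
    have hνμ : ν < μ := (Finset.mem_filter.1 hν).2
    have h1 := zsum_sq_le (fun t => oc B ν μ (stepSite P j (mixSite ν (emb y) (Site.blockSite y r)) ν t))
      (((r ν : ℕ) : ℤ) - (((P.L - 1) / 2 : ℕ) : ℤ)) (M := M) (fun t ht => by
        rw [oc_eq_curl B hνμ]
        exact Finset.single_le_sum (f := fun p : Plaq P j => curl 1 B p ^ 2) (fun _ _ => sq_nonneg _)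
          (Finset.mem_filter.2 ⟨Finset.mem_univ _, blockOf_stepSite_mixSite hj y r ν ht⟩))
    have h2 := natAbs_offset_le (P := P) r ν
    have h3 : (((((r ν : ℕ) : ℤ) - (((P.L - 1) / 2 : ℕ) : ℤ)).natAbs : ℕ) : ℝ) ^ 2 ≤ (P.L : ℝ) ^ 2 :=
      pow_le_pow_left₀ (Nat.cast_nonneg _) h2 2
    exact h1.trans (mul_le_mul_of_nonneg_right h3 hM0)
  rw [apply_eq_sum_zsum_of_axial hj B y hB r μ hμ]
  calc (∑ ν ∈ S, Z ν) ^ 2 ≤ S.card * ∑ ν ∈ S, Z ν ^ 2 := sq_sum_le_card_mul_sum_sq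
    _ ≤ S.card * ∑ ν ∈ S, (P.L : ℝ) ^ 2 * M := mul_le_mul_of_nonneg_left (Finset.sum_le_sum hZle) (Nat.cast_nonneg _)
    _ = S.card * (S.card * ((P.L : ℝ) ^ 2 * M)) := by rw [Finset.sum_const, nsmul_eq_mul]
    _ ≤ P.d * (P.d * ((P.L : ℝ) ^ 2 * M)) := by
        have h4 : (S.card : ℝ) * ((P.L : ℝ) ^ 2 * M) ≤ P.d * ((P.L : ℝ) ^ 2 * M) := mul_le_mul_of_nonneg_right hcard (by positivity)
        exact mul_le_mul hcard h4 (by positivity) (Nat.cast_nonneg _)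
    _ = (P.d : ℝ) ^ 2 * (P.L : ℝ) ^ 2 * M := by ring

/-- neighbouring coarse sites are distinct (`N_{j+1} ≥ 2`). [cite: Balaban1987RG1, (0.3) p.252] -/
theorem shift_ne_self (y : Site P (j + 1)) (μ : Fin P.d) : y.shift μ ≠ y := by
  intro h
  have h1 : (y.shift μ) μ = y μ := by rw [h]
  simp only [Site.shift, Function.update_self] at h1
  have h2 : (1 : ZMod (P.sitesPerDir (j + 1))) = 0 := by
    calc (1 : ZMod (P.sitesPerDir (j + 1))) = (y μ + 1) - y μ := by ring
      _ = 0 := by rw [h1, sub_self]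
  exact one_ne_zero h2

/-- a bond with both end points in `B(y)` (*"b ⊂ B(y)"* of (2.123)) is `⟨(y, r), μ⟩` with `r_μ + 1 < L`. [cite: Balaban1984PropagatorsII, (2.123) p.244] -/
theorem exists_offset_of_inBlock (hj : j + 1 ≤ P.m + P.K) {y : Site P (j + 1)} {b : PBond P j}
    (hs : blockOf b.src = y) (ht : blockOf b.tgt = y) :
    ∃ r : Fin P.d → Fin P.L, b.src = Site.blockSite y r ∧ (r b.dir : ℕ) + 1 < P.L := by
  obtain ⟨r, hr⟩ := exists_blockSite_eq hj b.src
  rw [hs] at hr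
  refine ⟨r, hr.symm, ?_⟩
  have hlt := (r b.dir).isLt
  by_contra hne
  have heq : (r b.dir : ℕ) + 1 = P.L := by omega
  have h1 : b.tgt = Site.blockSite (y.shift b.dir) (Function.update r b.dir ⟨0, P.L_pos⟩) := by
    rw [PBond.tgt, ← hr, shift_blockSite_of_eq hj y r b.dir heq]
  rw [h1, Site.blockOf_blockSite hj] at ht
  exact shift_ne_self y b.dir ht

/-- a sum over bonds is a double sum over sites and directions. [folklore] -/
private theorem sum_bond_eq {α : Type*} [AddCommMonoid α] (F : PBond P j → α) :
    ∑ b : PBond P j, F b = ∑ x : Site P j, ∑ μ : Fin P.d, F ⟨x, μ⟩ :=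
  calc ∑ b : PBond P j, F b = ∑ p : Site P j × Fin P.d, F (bondEquiv p) := (Equiv.sum_comp (bondEquiv (P := P) (j := j)) F).symm
    _ = ∑ x : Site P j, ∑ μ : Fin P.d, F ⟨x, μ⟩ := Fintype.sum_prod_type _

/-- the number of bonds starting in `B(y)` is `d·L^d` (`|B(y)| = L^d`). [cite: Balaban1987RG1, (0.3) p.252] -/
theorem card_srcBlock (hj : j + 1 ≤ P.m + P.K) (y : Site P (j + 1)) :
    (Finset.univ.filter (fun b : PBond P j => blockOf b.src = y)).card = P.d * P.L ^ P.d := by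
  classical
  rw [Finset.card_filter, sum_bond_eq]
  have h : ∀ x : Site P j, ∑ μ : Fin P.d, (if blockOf (⟨x, μ⟩ : PBond P j).src = y then 1 else 0) = if blockOf x = y then P.d else 0 := by
    intro x
    show ∑ μ : Fin P.d, (if blockOf x = y then 1 else 0) = if blockOf x = y then P.d else 0
    split_ifs
    · simp
    · simp
  rw [Finset.sum_congr rfl (fun x _ => h x), ← Finset.sum_filter]
  simp only [Finset.sum_const, smul_eq_mul]
  have hc : (Finset.univ.filter (fun x : Site P j => blockOf x = y)).card = P.L ^ P.d := by
    rw [← Site.card_block hj y]; rfl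
  rw [hc, mul_comm]

/-- **(2.123) for the centred trees, summed over the block**: for `B` axial on `B(y)`,
`Σ_{b⊂B(y)} |B(b)|² ≤ d³L^{d+2} Σ_{p : p₋∈B(y)} |(∂₁B)(p)|²` (printed constant `dL^d`; ours bounds each of the `≤ dL^d` bonds by `sq_le_curlBlk`).
[cite: Balaban1984PropagatorsII, (2.123) p.244] -/
theorem inBlk_le_curlBlk (hj : j + 1 ≤ P.m + P.K) (B : VecField P j ℝ) (y : Site P (j + 1))
    (hB : ∀ r : Fin P.d → Fin P.L, stairSum B (emb y) (Site.blockSite y r) = 0) :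
    ∑ b ∈ Finset.univ.filter (fun b : PBond P j => blockOf b.src = y ∧ blockOf b.tgt = y), B b ^ 2 ≤
      (P.d : ℝ) ^ 3 * (P.L : ℝ) ^ (P.d + 2) * ∑ p ∈ Finset.univ.filter (fun p : Plaq P j => blockOf p.src = y), curl 1 B p ^ 2 := by
  classical
  set M := ∑ p ∈ Finset.univ.filter (fun p : Plaq P j => blockOf p.src = y), curl 1 B p ^ 2 with hM
  have hM0 : 0 ≤ M := Finset.sum_nonneg fun _ _ => sq_nonneg _
  have hpt : ∀ b ∈ Finset.univ.filter (fun b : PBond P j => blockOf b.src = y ∧ blockOf b.tgt = y),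
      B b ^ 2 ≤ (P.d : ℝ) ^ 2 * (P.L : ℝ) ^ 2 * M := by
    intro b hb
    obtain ⟨hs, ht⟩ := (Finset.mem_filter.1 hb).2
    obtain ⟨r, hr, hμ⟩ := exists_offset_of_inBlock hj hs ht
    have e : b = ⟨Site.blockSite y r, b.dir⟩ := by cases b; simp only at hr; rw [hr]
    rw [e]
    exact sq_le_curlBlk hj B y hB r b.dir hμ
  have hsub : Finset.univ.filter (fun b : PBond P j => blockOf b.src = y ∧ blockOf b.tgt = y) ⊆
      Finset.univ.filter (fun b : PBond P j => blockOf b.src = y) := fun b hb => by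
    rw [Finset.mem_filter] at hb ⊢
    exact ⟨hb.1, hb.2.1⟩
  calc ∑ b ∈ Finset.univ.filter (fun b : PBond P j => blockOf b.src = y ∧ blockOf b.tgt = y), B b ^ 2
      ≤ ∑ b ∈ Finset.univ.filter (fun b : PBond P j => blockOf b.src = y ∧ blockOf b.tgt = y), (P.d : ℝ) ^ 2 * (P.L : ℝ) ^ 2 * M :=
        Finset.sum_le_sum hpt
    _ ≤ ∑ b ∈ Finset.univ.filter (fun b : PBond P j => blockOf b.src = y), (P.d : ℝ) ^ 2 * (P.L : ℝ) ^ 2 * M :=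
        Finset.sum_le_sum_of_subset_of_nonneg hsub fun _ _ _ => by positivity
    _ = ((P.d * P.L ^ P.d : ℕ) : ℝ) * ((P.d : ℝ) ^ 2 * (P.L : ℝ) ^ 2 * M) := by
        rw [Finset.sum_const, nsmul_eq_mul, card_srcBlock hj y]
    _ = (P.d : ℝ) ^ 3 * (P.L : ℝ) ^ (P.d + 2) * M := by push_cast; ring

end Block



end Literature.MathematicalPhysics.QuantumFieldTheory.Balaban1983to89.B6Ineq2123CentredTorus

end
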